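import Literature.IUT.HodgeTheaters.InitialThetaDataRemarksProofs
import Mathlib.FieldTheory.Normal.Closure
import HarnessLib

/-!
# [IUTchI] Remark 3.1.5 in Mathlib's currency: `IsGalois (F_mod) K` for initial Θ-data

Mochizuki, *Inter-universal Teichmüller theory I*, RIMS manuscript (May 2020), Remark 3.1.5, first
sentence (kurims p. 65): "Note that since the `3`-torsion points of `E_F` are rational over `F`, and
`F` is Galois over `F_mod`, it follows [cf., e.g., [IUTchIV], Proposition 1.8, (iv)] that `K` is Galois
over `F_mod`."  The tree's `InitialThetaDataRemarksProofs.lean` PROVES this in the typed form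
`InitialThetaData.KGaloisOverFieldOfModuli` (every ring automorphism of `F̄` fixing `F_mod` pointwise
carries `K ⊆ F̄` into itself, `kGaloisOverFieldOfModuli_holds`).  This proof-only companion converts it
into the Mathlib class **`IsGalois (fieldOfModuli E) K`** (`InitialThetaData.isGalois_fieldOfModuli_K`):
`F̄` is an algebraic closure of `F_mod` (`F/F_mod` finite), so the image of `K` is a normal
intermediate field by Mathlib's `IntermediateField.normal_iff_forall_map_le'`, normality transports
along `K ≃ K(image)`, and separability is automatic in characteristic `0`.

Consumer: the Galois-fibre invariance of the local different exponents of the completions `K_{v̲}`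
along the section `V̲ ≅ V_mod` in [IUTchIV] Thm. 1.10 Step (v) (abc-iut-S1's
`Literature/IUT/LogVolume/DifferentOrdGaloisFibre.lean`, hypotheses `[IsGalois F₀ K]`).
Theorems only; nothing of the statement files is restated; nothing here bears on [IUTchIII] Cor. 3.12.
-/

noncomputable section

open scoped Classical

universe u v w

namespace Literature.IUT.HodgeTheaters

namespace InitialThetaData

variable {F : Type u} {K : Type v} {Fbar : Type w} [Field F] [NumberField F] [Field K]
  [NumberField K] [Algebra F K] [Field Fbar] [Algebra F Fbar] [Algebra K Fbar]
  {E : WeierstrassCurve F} [E.IsElliptic] {l : ℕ} {P : BadPlacePredicates K}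
  (D : InitialThetaData F K Fbar E l P)

include D

/-- `K → F̄` is a morphism of `F_mod`-algebras (the towers `F_mod ⊆ F ⊆ K ⊆ F̄`).
[claim: Mochizuki2012, status: disputed] -/
theorem isScalarTower_fieldOfModuli_K_Fbar : IsScalarTower (fieldOfModuli E) K Fbar := by
  haveI := D.isScalarTower
  refine IsScalarTower.of_algebraMap_eq fun x => ?_
  rw [IsScalarTower.algebraMap_apply (fieldOfModuli E) F K, ← IsScalarTower.algebraMap_apply F K Fbar,
    IsScalarTower.algebraMap_apply (fieldOfModuli E) F Fbar]

/-- `F̄` is an algebraic closure of `F_mod` (`F/F_mod` is finite). [claim: Mochizuki2012, status: disputed] -/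
theorem isAlgClosure_fieldOfModuli : IsAlgClosure (fieldOfModuli E) Fbar := by
  haveI := D.isAlgClosure
  haveI : Algebra.IsAlgebraic (fieldOfModuli E) F := Algebra.IsAlgebraic.of_finite (fieldOfModuli E) F
  exact IsAlgClosure.ofAlgebraic (fieldOfModuli E) F Fbar

/-- **[IUTchI] Remark 3.1.5 (p. 65), Mathlib form: `K` is Galois over `F_mod`** for initial Θ-data —
from the tree's `kGaloisOverFieldOfModuli_holds` (stability of `K ⊆ F̄` under `Aut(F̄/F_mod)`).
[claim: Mochizuki2012, status: disputed] -/
theorem isGalois_fieldOfModuli_K : IsGalois (fieldOfModuli E) K := by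
  haveI := D.isScalarTower
  haveI := D.isScalarTower_fieldOfModuli_K_Fbar
  haveI := D.isAlgClosure_fieldOfModuli
  set F₀ := fieldOfModuli E with hF₀
  let φ : K →ₐ[F₀] Fbar := IsScalarTower.toAlgHom F₀ K Fbar
  -- the image of `K` in `F̄` is a normal intermediate field
  have hK' : Normal F₀ φ.fieldRange := by
    rw [IntermediateField.normal_iff_forall_map_le']
    intro σ x hx
    rw [IntermediateField.mem_map] at hx
    obtain ⟨y, hy, rfl⟩ := hx
    rw [AlgHom.mem_fieldRange] at hy
    obtain ⟨k, rfl⟩ := hy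
    have hσ : ∀ x : fieldOfModuli E, (σ : Fbar ≃+* Fbar) (algebraMap F Fbar (x : F)) =
        algebraMap F Fbar (x : F) := by
      intro x
      have h1 : algebraMap F Fbar (x : F) = algebraMap F₀ Fbar x :=
        (IsScalarTower.algebraMap_apply F₀ F Fbar x).symm
      rw [h1]
      exact σ.commutes x
    obtain ⟨k', hk'⟩ := D.kGaloisOverFieldOfModuli_holds (σ : Fbar ≃+* Fbar) hσ k
    rw [AlgHom.mem_fieldRange]
    exact ⟨k', by simpa [φ] using hk'⟩
  -- `K ≃ K(image)` as `F_mod`-algebras (`φ.range = φ.fieldRange` as sets)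
  have e : K ≃ₐ[F₀] φ.fieldRange :=
    (AlgEquiv.ofInjectiveField φ).trans (Subalgebra.equivOfEq _ _ φ.fieldRange_toSubalgebra.symm)
  haveI : Normal F₀ K := Normal.of_algEquiv e.symm
  haveI : Algebra.IsAlgebraic F₀ K := Algebra.IsAlgebraic.of_finite F₀ K
  exact isGalois_iff.mpr ⟨inferInstance, inferInstance⟩

end InitialThetaData

end Literature.IUT.HodgeTheaters

end
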